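import Summits.MatrixMultiplication.MatrixMultiplication.Theses.MarginalColumns
import Summits.MatrixMultiplication.MatrixMultiplication.Theorems.SecondColumnDominates.Negative.LoadBearing
import Literature.Computability.AlgebraicComplexity.BorderRankMatMulSmallProofs

/-!
# `CubeNineteenOfDominates` (route `MarginalColumns`, support item stmt-MatrixMultiplication-16315)

`SecondColumnDominates → R̲⟨3,3,3⟩ ≤ 19`: the crux D = `SecondColumnDominates`
(stmt-MatrixMultiplication-16310) at its first open cell `(n, w) = (3, 2)` reads
`R̲⟨3,3,3⟩ + R̲⟨3,3,1⟩ ≤ R̲⟨3,3,2⟩ + R̲⟨3,3,2⟩`; with `R̲⟨3,3,1⟩ = 9` (flattening / standard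
algorithm, `Negative.algBorderRank_matMulTensor_sq_one`) and Smirnov's `R̲⟨3,3,2⟩ ≤ 14`
(`Smirnov2013_algBorderRank_matMulTensor_332_le`, PROVED in tree from his `⟨3,2,3; 14⟩` table) this
is `R̲⟨3,3,3⟩ ≤ 28 − 9 = 19`, the existing open item stmt-MatrixMultiplication-8008
(`CubeNineteen`, printed window `[17, 20]`, both ends proved in tree). So `R̲⟨3,3,3⟩ = 20` refutes D,
and D cannot be settled before stmt-MatrixMultiplication-8008 is.

Landed by the line lead of crux stmt-MatrixMultiplication-16310 (line `Sketch`) as the formal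
content of the dependency "D is blocked on CubeNineteen".
-/

set_option linter.dupNamespace false

noncomputable section

namespace Summit.MatrixMultiplication.MatrixMultiplication.Theorems

open Literature.Computability.AlgebraicComplexity
open Summit.MatrixMultiplication.MatrixMultiplication.Theses.MarginalColumns

/-- **D ⇒ `R̲⟨3,3,3⟩ ≤ 19`.** The cell `(3,2)` of `SecondColumnDominates` with `R̲⟨3,3,1⟩ = 9` and
`R̲⟨3,3,2⟩ ≤ 14` (Smirnov 2013). [cite: Smirnov2013, Table 4] -/
theorem cubeNineteenOfDominates_proof : CubeNineteenOfDominates := by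
  unfold CubeNineteenOfDominates SecondColumnDominates
  intro hD
  have h := hD 3 2 (by norm_num) (by norm_num)
  simp only [Nat.reduceAdd] at h
  have h14 : algBorderRank (matMulTensor ℂ 3 3 2) ≤ 14 :=
    Smirnov2013_algBorderRank_matMulTensor_332_le ℂ
  have h9 : algBorderRank (matMulTensor ℂ 3 3 1) = 3 * 3 :=
    SecondColumnDominates.Negative.algBorderRank_matMulTensor_sq_one 3
  omega

end Summit.MatrixMultiplication.MatrixMultiplication.Theorems

end
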